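import Literature.AlgebraicGeometry.HodgeTheory.NodalHypersurface
import HarnessLib

/-!
# Nodal divisors (reduced effective Cartier divisors with `k` ordinary double points)

Topic `Literature/AlgebraicGeometry/HodgeTheory`. Definition request `defn-IsNodalDivisor` (route
`HodgeConjecture/NodalThetaWeil`, crux `NodalThetaSupport`: "the Weil class is supported on a NODAL
member of `|kΘ|`" on an abelian variety; also route `NodalSupport` and card
thimble-lattice-nodal-certificates). It is the sibling of `IsNodalHypersurface n d k X`
(`HodgeTheory/NodalHypersurface`: `k`-nodal hypersurfaces of `ℙⁿ⁺¹`) with the ambient projective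
space replaced by an arbitrary ambient `K`-scheme `X` (in applications a smooth projective variety,
e.g. an abelian variety) and the degree replaced by the requirement that `D ↪ X` be an **effective
Cartier divisor**.

* `IsEffectiveCartierIdeal I` — the quasi-coherent ideal sheaf `I` (Mathlib `Scheme.IdealSheafData`)
  is, locally around every point, generated by a single non-zero-divisor: Stacks 01WR/01WS ("an
  effective Cartier divisor on `S` is a closed subscheme `D ⊆ S` whose ideal sheaf is an invertible
  `𝒪_S`-module", equivalently "for every `x ∈ D` there is an affine open neighbourhood
  `Spec A = U ⊆ S` of `x` such that `U ∩ D = Spec (A/(f))` with `f ∈ A` a nonzerodivisor");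
  Hartshorne II.6 (effective Cartier divisors, p. 145). Rendered on Mathlib's affine-local data:
  `∀ y, ∃ U ∋ y` affine open, `∃ f ∈ Γ(X, U)⁰` (`nonZeroDivisors`), `I(U) = (f)`.
* `IsNodalDivisor n k ι` — **`ι : D ⟶ X` is a `k`-nodal divisor of dimension `n`** (over the field
  `K`; morphism of `K`-schemes, `SchemeOver K = Over (Spec K)`): `ι` is a closed immersion whose
  ideal sheaf `ker ι` (Mathlib `Scheme.Hom.ker`) is effective Cartier, `D` is reduced, and the
  singular locus `{x ∈ D | 𝒪_{D,x} not regular}` is a finite set of exactly `k` closed points, each a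
  node of dimension `n` (`IsNode K n`, the completed local ring `≅ K⟦u₀,…,u_n⟧/(Σ uᵢ²)`) — Thomas
  2005, §1: "By 'nodal' we mean … only singularities … analytically equivalent to ordinary double
  points (ODPs)"; Dimca 1992, Ch. 1 §3. Here `n = dim D = dim X - 1` is carried as a parameter,
  exactly as in `IsNodalHypersurface n d k` (the consumer knows it: `n = g - 1` for a theta divisor
  on an abelian `g`-fold).
* API (pattern of `IsNodalHypersurface`): `nodes` (the `Finset` of singular points of `D`) with
  `card_nodes`, `mem_nodes_iff`, `coe_nodes`, `isClosed_of_mem_nodes`, `isNode_of_mem_nodes`,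
  `isRegularLocalRing_of_not_mem_nodes`, `count_eq`; the **support** `support ι = range ι ⊆ X`
  (`isClosed_support`, to feed `restrictCompl` / `classesSupportedOn`-type statements) and the nodes
  seen in the ambient scheme `ambientNodes` (`card_ambientNodes`: still `k`, a closed immersion being
  injective); `isNodalDivisor_zero_iff` (`0`-nodal = smooth-in-the-sense-of-regular reduced
  effective Cartier divisor); compatibility with nodal hypersurfaces
  `IsNodalHypersurface.isNodalDivisor` — a `k`-nodal hypersurface `X = V₊(F) ⊆ ℙⁿ⁺¹` is a
  `k`-nodal divisor of `ℙⁿ⁺¹` along any closed `K`-immersion `ι : X ⟶ ℙⁿ⁺¹` **whose ideal is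
  effective Cartier** (that `V₊(F)` with its reduced structure has ideal sheaf locally `(F/xᵢᵈ)`,
  `F` irreducible, is Hartshorne II.6.17.1/II.5.14 and is NOT proved here: `IsHypersurfaceCutOutBy`
  is set-theoretic, and the tree has no graded-quotient `Proj`; the clause is kept as a hypothesis).

## Design notes

* Same conventions and caveats as `IsNodalHypersurface`: singular = non-regular local ring
  (Hartshorne II.8.14A); `IsNode K n` is THE node over `K = ℂ` (or `K` algebraically closed of
  characteristic `≠ 2`), the intended setting; the finite singular set is packaged as a `Finset`
  witness (no `Set.ncard` junk).
* `D` reduced is a clause, as requested ("reduced effective Cartier divisor"); for `n ≥ 1` a nodal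
  `D` is automatically reduced away from the nodes (regular local rings are domains) and at the
  nodes (`K⟦u⟧/(Σuᵢ²)` is a domain for `n ≥ 2`, reduced for `n = 1`), but deriving `IsReduced` from
  the stalks is not needed to STATE the notion.
* Nothing requires `X` smooth or projective: those are hypotheses of the consumer
  (`IsSmoothProjective g A.X`), orthogonal to the notion.
* Mathlib: `Scheme.IdealSheafData` (`ideal U`), `Scheme.Hom.ker` (`Hom.ker_apply` for quasi-compact
  morphisms, e.g. closed immersions), `IsClosedImmersion` (`isClosedEmbedding`), `nonZeroDivisors`,
  `IsRegularLocalRing`, `IsReduced`; Mathlib has no (effective Cartier) divisors on schemes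
  (`grep Cartier Mathlib/AlgebraicGeometry`: nothing), whence `IsEffectiveCartierIdeal` here.

## References

* R. P. Thomas, *Nodes and the Hodge conjecture*, J. Algebraic Geom. 14 (2005) 177–185, §1.
  [Thomas2005Nodes]
* A. Dimca, *Singularities and Topology of Hypersurfaces* (1992), Ch. 1 §3. [Dimca1992]
* The Stacks project, Tags 01WR, 01WS (effective Cartier divisors). [StacksProject]
* R. Hartshorne, *Algebraic Geometry* (1977), II.6 (Cartier divisors, pp. 140–146), II.8.14A.
  [Hartshorne1977]
-/

noncomputable section

open CategoryTheory AlgebraicGeometry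

universe u

namespace Literature.AlgebraicGeometry.HodgeTheory

open Literature.AlgebraicGeometry.Motives

/-! ## Effective Cartier ideal sheaves -/

section Cartier

variable {Y : Scheme.{u}}

/-- The quasi-coherent ideal sheaf `I` of `Y` **is effective Cartier**: every point of `Y` has an
affine open neighbourhood `U` on which `I(U) ⊆ Γ(Y, U)` is generated by a single non-zero-divisor
(so the closed subscheme `V(I)` is an effective Cartier divisor of `Y`; where `I(U) = (1)` the
divisor is empty near `U`). Stacks 01WR–01WS; Hartshorne II.6 (p. 145).
[cite: StacksProject, Tag 01WS] -/
def IsEffectiveCartierIdeal (I : Y.IdealSheafData) : Prop :=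
  ∀ y : Y, ∃ U : Y.affineOpens, y ∈ (U : Y.Opens) ∧
    ∃ f : Γ(Y, U), f ∈ nonZeroDivisors Γ(Y, U) ∧ I.ideal U = Ideal.span {f}

/-- Unfolding of `IsEffectiveCartierIdeal`. [cite: StacksProject, Tag 01WS] -/
theorem isEffectiveCartierIdeal_iff (I : Y.IdealSheafData) :
    IsEffectiveCartierIdeal I ↔
      ∀ y : Y, ∃ U : Y.affineOpens, y ∈ (U : Y.Opens) ∧
        ∃ f : Γ(Y, U), f ∈ nonZeroDivisors Γ(Y, U) ∧ I.ideal U = Ideal.span {f} :=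
  Iff.rfl

/-- The unit ideal sheaf `⊤` (empty divisor) is effective Cartier: `I(U) = (1)` on every affine
open, and every point lies in some affine open. [cite: StacksProject, Tag 01WS] -/
theorem isEffectiveCartierIdeal_top : IsEffectiveCartierIdeal (⊤ : Y.IdealSheafData) := by
  intro y
  obtain ⟨U, hU, hyU, -⟩ := (TopologicalSpace.Opens.isBasis_iff_nbhd.1 Y.isBasis_affineOpens)
    (TopologicalSpace.Opens.mem_top y)
  refine ⟨⟨U, hU⟩, hyU, 1, one_mem _, ?_⟩
  simp

end Cartier

/-! ## `k`-nodal divisors of dimension `n` -/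

section Divisor

variable {K : Type u} [Field K]

/-- **`ι : D ⟶ X` is a `k`-nodal divisor of dimension `n`** over `K` (Thomas 2005, §1: nodal =
only singularities analytically equivalent to ordinary double points; Dimca 1992, Ch. 1 §3):
`ι` is a closed immersion of `K`-schemes whose ideal sheaf `ker ι ⊆ 𝒪_X` is effective Cartier
(`IsEffectiveCartierIdeal`, Stacks 01WS: `D` is an effective Cartier divisor of `X`), `D` is
reduced, and the singular locus `{x ∈ D | 𝒪_{D,x} is not regular}` is a finite set of exactly `k`
closed points of `D`, each a node of dimension `n` (`IsNode K n x`: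
`𝒪̂_{D,x} ≅ K⟦u₀, …, u_n⟧/(u₀² + ⋯ + u_n²)`). The sibling of `IsNodalHypersurface n d k` with
`ℙⁿ⁺¹` replaced by an arbitrary ambient `X` and the degree by the Cartier condition; `n = dim D`
is a parameter (intended: `X` smooth of dimension `n + 1`, `K = ℂ`).
[cite: Thomas2005Nodes, §1 (definition of "nodal")] [cite: StacksProject, Tag 01WS] -/
def IsNodalDivisor (n k : ℕ) {D X : SchemeOver K} (ι : D ⟶ X) : Prop :=
  IsClosedImmersion ι.left ∧ IsEffectiveCartierIdeal ι.left.ker ∧ IsReduced D.left ∧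
    ∃ S : Finset D.left,
      S.card = k ∧
        (∀ x : D.left, x ∈ S ↔ ¬ IsRegularLocalRing (D.left.presheaf.stalk x)) ∧
          ∀ x ∈ S, IsClosed ({x} : Set D.left) ∧ IsNode K n x

variable {n k : ℕ} {D X : SchemeOver K} {ι : D ⟶ X}

/-- The **support** of `ι : D ⟶ X` in the ambient scheme: the image of the underlying continuous
map (for a closed immersion, the closed subset `D ⊆ X`). [folklore] -/
def support (ι : D ⟶ X) : Set X.left :=
  Set.range ι.left.base

/-- Membership in the support. [folklore] -/
theorem mem_support_iff (ι : D ⟶ X) (y : X.left) : y ∈ support ι ↔ ∃ x : D.left, ι.left.base x = y :=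
  Iff.rfl

namespace IsNodalDivisor

/-- A nodal divisor is a closed subscheme. [folklore] -/
theorem isClosedImmersion (h : IsNodalDivisor n k ι) : IsClosedImmersion ι.left :=
  h.1

/-- A nodal divisor is an effective Cartier divisor: its ideal sheaf is locally generated by one
non-zero-divisor. [cite: StacksProject, Tag 01WS] -/
theorem isEffectiveCartierIdeal (h : IsNodalDivisor n k ι) : IsEffectiveCartierIdeal ι.left.ker :=
  h.2.1

/-- A nodal divisor is a reduced scheme. [folklore] -/
theorem isReduced (h : IsNodalDivisor n k ι) : IsReduced D.left :=
  h.2.2.1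

/-- The support of a nodal divisor is closed in the ambient scheme (a closed immersion is a closed
embedding). [folklore] -/
theorem isClosed_support (h : IsNodalDivisor n k ι) : IsClosed (support ι) := by
  haveI := h.isClosedImmersion
  exact ι.left.isClosedEmbedding.isClosed_range

/-- The underlying map of a nodal divisor is injective. [folklore] -/
theorem injective_base (h : IsNodalDivisor n k ι) : Function.Injective ι.left.base := by
  haveI := h.isClosedImmersion
  exact ι.left.isClosedEmbedding.injective

/-- **The nodes** of a `k`-nodal divisor: the finite set of singular points of `D` (chosen witness
of the definition; it is THE set of non-regular points, `mem_nodes_iff`). [folklore] -/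
def nodes (h : IsNodalDivisor n k ι) : Finset D.left :=
  h.2.2.2.choose

/-- A `k`-nodal divisor has exactly `k` nodes. [folklore] -/
theorem card_nodes (h : IsNodalDivisor n k ι) : h.nodes.card = k :=
  h.2.2.2.choose_spec.1

/-- The nodes are exactly the singular (non-regular) points of `D`. [folklore] -/
theorem mem_nodes_iff (h : IsNodalDivisor n k ι) (x : D.left) :
    x ∈ h.nodes ↔ ¬ IsRegularLocalRing (D.left.presheaf.stalk x) :=
  h.2.2.2.choose_spec.2.1 x

/-- The set of singular points of a nodal divisor is (the coercion of) `nodes`. [folklore] -/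
theorem coe_nodes (h : IsNodalDivisor n k ι) :
    (h.nodes : Set D.left) = {x | ¬ IsRegularLocalRing (D.left.presheaf.stalk x)} :=
  Set.ext fun x => by simpa using h.mem_nodes_iff x

/-- Every node is a closed point of `D`. [folklore] -/
theorem isClosed_of_mem_nodes (h : IsNodalDivisor n k ι) {x : D.left} (hx : x ∈ h.nodes) :
    IsClosed ({x} : Set D.left) :=
  (h.2.2.2.choose_spec.2.2 x hx).1

/-- Every singular point of a nodal divisor is a node (ordinary double point). [folklore] -/
theorem isNode_of_mem_nodes (h : IsNodalDivisor n k ι) {x : D.left} (hx : x ∈ h.nodes) :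
    IsNode K n x :=
  (h.2.2.2.choose_spec.2.2 x hx).2

/-- Off the nodes the local rings of `D` are regular. [folklore] -/
theorem isRegularLocalRing_of_not_mem_nodes (h : IsNodalDivisor n k ι) {x : D.left}
    (hx : x ∉ h.nodes) : IsRegularLocalRing (D.left.presheaf.stalk x) := by
  by_contra hreg
  exact hx ((h.mem_nodes_iff x).2 hreg)

/-- The number of nodes is determined by the divisor. [folklore] -/
theorem count_eq {k' : ℕ} (h : IsNodalDivisor n k ι) (h' : IsNodalDivisor n k' ι) : k = k' := by
  have hS : h.nodes = h'.nodes := by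
    ext x
    rw [h.mem_nodes_iff, h'.mem_nodes_iff]
  rw [← h.card_nodes, ← h'.card_nodes, hS]

open Classical in
/-- **The nodes seen in the ambient scheme**: the images in `X` of the nodes of `D`. [folklore] -/
def ambientNodes (h : IsNodalDivisor n k ι) : Finset X.left :=
  h.nodes.image ι.left.base

/-- There are still exactly `k` nodes in the ambient scheme (a closed immersion is injective).
[folklore] -/
theorem card_ambientNodes (h : IsNodalDivisor n k ι) : h.ambientNodes.card = k := by
  classical
  rw [ambientNodes, Finset.card_image_of_injective _ h.injective_base, h.card_nodes]

/-- The ambient nodes lie on the support of the divisor. [folklore] -/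
theorem ambientNodes_subset_support (h : IsNodalDivisor n k ι) :
    (h.ambientNodes : Set X.left) ⊆ support ι := by
  classical
  intro y hy
  obtain ⟨x, -, rfl⟩ := Finset.mem_image.1 (Finset.mem_coe.1 hy)
  exact ⟨x, rfl⟩

end IsNodalDivisor

/-- **`0`-nodal divisors**: `ι` is a `0`-nodal divisor of dimension `n` iff it is a closed
immersion with effective Cartier ideal, `D` is reduced, and all local rings of `D` are regular
(over a perfect field: a smooth reduced effective Cartier divisor). [folklore] -/
theorem isNodalDivisor_zero_iff :
    IsNodalDivisor n 0 ι ↔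
      IsClosedImmersion ι.left ∧ IsEffectiveCartierIdeal ι.left.ker ∧ IsReduced D.left ∧
        ∀ x : D.left, IsRegularLocalRing (D.left.presheaf.stalk x) := by
  refine and_congr_right fun _ => and_congr_right fun _ => and_congr_right fun _ =>
    ⟨?_, fun hreg => ⟨∅, rfl, fun x => by simpa using hreg x, ?_⟩⟩
  · rintro ⟨S, hS, hmem, -⟩ x
    have hS' : S = ∅ := Finset.card_eq_zero.1 hS
    by_contra hx
    have := (hmem x).2 hx
    rw [hS'] at this
    exact absurd this (Finset.notMem_empty x)
  · intro x hx
    exact absurd hx (Finset.notMem_empty x)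

/-- **Nodal hypersurfaces are nodal divisors of projective space** (compatibility with
`IsNodalHypersurface`): a `k`-nodal hypersurface `X = V₊(F) ⊆ ℙⁿ⁺¹_K` of dimension `n` is a
`k`-nodal divisor of dimension `n` of `ℙⁿ⁺¹_K` along every closed `K`-immersion
`ι : X ⟶ ℙⁿ⁺¹_K` whose ideal sheaf is effective Cartier. (That the reduced hypersurface `V₊(F)`,
`F` irreducible of degree `d`, has ideal sheaf locally `(F/xᵢᵈ)` — Hartshorne II.5.14/II.6.17.1 —
is not derivable from the set-theoretic `IsHypersurfaceCutOutBy` without graded quotients of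
`Proj`, and is kept as the hypothesis `hC`.) [folklore] -/
theorem IsNodalHypersurface.isNodalDivisor {n d k : ℕ} {X : SchemeOver K}
    (h : IsNodalHypersurface n d k X) {ι : X ⟶ projectiveSpace (n + 1) K}
    (hι : IsClosedImmersion ι.left) (hC : IsEffectiveCartierIdeal ι.left.ker) :
    IsNodalDivisor n k ι :=
  ⟨hι, hC, h.isReduced, h.2⟩

/-- Conversely the node data of a nodal divisor structure on a hypersurface of `ℙⁿ⁺¹` cut out by an
irreducible form of degree `d` make it a `k`-nodal hypersurface. [folklore] -/
theorem IsNodalDivisor.isNodalHypersurface {n d k : ℕ} {X : SchemeOver K}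
    {ι : X ⟶ projectiveSpace (n + 1) K} (h : IsNodalDivisor n k ι)
    (hF : ∃ F : MvPolynomial (Fin (n + 2)) K,
      F.IsHomogeneous d ∧ Irreducible F ∧ IsHypersurfaceCutOutBy (n + 1) F X) :
    IsNodalHypersurface n d k X :=
  ⟨hF, h.2.2.2⟩

end Divisor

end Literature.AlgebraicGeometry.HodgeTheory

end
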